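import Mathlib.NumberTheory.Chebyshev
import Mathlib.Analysis.SpecialFunctions.Pow.Real
import Mathlib.Analysis.Complex.Exponential
import HarnessLib

/-!
# The prime number theorem with the de la Vallée Poussin error term

Trunk `AntSieve` / `LFunctions` support file: the classical prime number theorem with the error
term of de la Vallée Poussin (1899), in the form printed as Montgomery–Vaughan,
*Multiplicative Number Theory I*, Theorem 6.9:
there is a constant `c > 0` such that
`ψ(x) = x + O(x exp(−c √log x))` (6.12) and `ϑ(x) = x + O(x exp(−c √log x))` (6.13).

Both are vendored as named facts (`def … : Prop`, D-0014: Literature is sorry-free); the deep input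
(the classical zero-free region and Perron's formula) is not in Mathlib.  Mathlib has the Chebyshev
functions `Chebyshev.psi`, `Chebyshev.theta` (`Mathlib.NumberTheory.Chebyshev`) with Chebyshev's
bounds, but no form of the prime number theorem with an error term.

We also PROVE the standard corollary used by sieve-theoretic consumers: for every real `A`,
`|ϑ(x) − x| ≤ C_A x/(log x)^A` for `x ≥ 2` (`ChebyshevThetaDeLaValleePoussin.logPow`, likewise for
`ψ`), from the Taylor bound `exp(y) ≥ y^{2k}/(2k)!` (`logPow_of_expSqrt`).

## Design notes

* `O(·)` for `x ≥ 2` with an unspecified absolute constant is rendered as `∃ C, ∀ x ≥ 2, |…| ≤ C · …`;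
  since both sides are bounded on compact ranges of `x ≥ 2` this is equivalent to the eventual form.
* The facts are stated with Mathlib's `Chebyshev.theta` / `Chebyshev.psi` (sums over `Ioc 0 ⌊x⌋₊`).

## References

* H. L. Montgomery, R. C. Vaughan, *Multiplicative Number Theory I. Classical Theory*, CUP 2007,
  Theorem 6.9, (6.12)–(6.13) (`lit read` PDF p. 143).
* C.-J. de la Vallée Poussin, Mém. Couronnés Acad. Roy. Belgique 59 (1899).
-/

open Real Finset

namespace Literature.NumberTheory.LFunctions

/-- **Prime number theorem with the de la Vallée Poussin error term, `ϑ`-form**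
(Montgomery–Vaughan, *Multiplicative Number Theory I*, Theorem 6.9, (6.13)): there is a constant
`c > 0` such that `ϑ(x) = x + O(x / exp(c √log x))`, i.e. there is `C` with
`|ϑ(x) − x| ≤ C x / exp(c √(log x))` for all `x ≥ 2`, where `ϑ(x) = ∑_{p ≤ x} log p` is Mathlib's
`Chebyshev.theta`. A THEOREM in print (zero-free region + Perron), not in Mathlib.
[cite: MontgomeryVaughan2007, Theorem 6.9 (6.13)] -/
def ChebyshevThetaDeLaValleePoussin : Prop :=
  ∃ c : ℝ, 0 < c ∧ ∃ C : ℝ, ∀ x : ℝ, 2 ≤ x →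
    |Chebyshev.theta x - x| ≤ C * x / Real.exp (c * Real.sqrt (Real.log x))

/-- **Prime number theorem with the de la Vallée Poussin error term, `ψ`-form**
(Montgomery–Vaughan, *Multiplicative Number Theory I*, Theorem 6.9, (6.12)): there is a constant
`c > 0` such that `ψ(x) = x + O(x / exp(c √log x))` for `x ≥ 2`, where `ψ(x) = ∑_{n ≤ x} Λ(n)` is
Mathlib's `Chebyshev.psi`. A THEOREM in print, not in Mathlib.
[cite: MontgomeryVaughan2007, Theorem 6.9 (6.12)] -/
def ChebyshevPsiDeLaValleePoussin : Prop :=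
  ∃ c : ℝ, 0 < c ∧ ∃ C : ℝ, ∀ x : ℝ, 2 ≤ x →
    |Chebyshev.psi x - x| ≤ C * x / Real.exp (c * Real.sqrt (Real.log x))

/-- `c^{2k} L^k / (2k)! ≤ exp(c √L)` for `L ≥ 0`, `c ≥ 0`: the Taylor lower bound
`exp y ≥ y^{2k}/(2k)!` at `y = c √L`. [folklore] -/
theorem pow_mul_pow_div_factorial_le_exp_sqrt {c L : ℝ} (hc : 0 ≤ c) (hL : 0 ≤ L) (k : ℕ) :
    c ^ (2 * k) * L ^ k / (2 * k).factorial ≤ Real.exp (c * Real.sqrt L) := by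
  have h := Real.pow_div_factorial_le_exp (c * Real.sqrt L) (mul_nonneg hc (Real.sqrt_nonneg L)) (2 * k)
  have hy : (c * Real.sqrt L) ^ (2 * k) = c ^ (2 * k) * L ^ k := by
    rw [mul_pow, pow_mul (Real.sqrt L), Real.sq_sqrt hL]
  rwa [hy] at h

/-- An error term `O(x / exp(c √log x))` (`c > 0`) is `O_A(x / (log x)^A)` for every real `A`,
uniformly for `x ≥ 2`: if `|f(x) − x| ≤ C x / exp(c √log x)` for `x ≥ 2` then
`|f(x) − x| ≤ C' x/(log x)^A` for `x ≥ 2` (Montgomery–Vaughan §6.2). [folklore] -/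
theorem logPow_of_expSqrt {f : ℝ → ℝ} {c C : ℝ} (hc : 0 < c)
    (hf : ∀ x : ℝ, 2 ≤ x → |f x - x| ≤ C * x / Real.exp (c * Real.sqrt (Real.log x))) (A : ℝ) :
    ∃ C' : ℝ, ∀ x : ℝ, 2 ≤ x → |f x - x| ≤ C' * x / Real.log x ^ A := by
  set k : ℕ := ⌈A⌉₊ with hk
  have hAk : A ≤ k := Nat.le_ceil A
  have hl2 : 0 < Real.log 2 := Real.log_pos one_lt_two
  refine ⟨max C 0 * (2 * k).factorial / c ^ (2 * k) / Real.log 2 ^ ((k : ℝ) - A),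
    fun x hx => ?_⟩
  have hx0 : 0 < x := by linarith
  set L := Real.log x with hLdef
  have hL2 : Real.log 2 ≤ L := Real.log_le_log two_pos hx
  have hL : 0 < L := hl2.trans_le hL2
  have hE : 0 < Real.exp (c * Real.sqrt L) := Real.exp_pos _
  have hck : 0 < c ^ (2 * k) := pow_pos hc _
  have hfact : (0 : ℝ) < (2 * k).factorial := by exact_mod_cast Nat.factorial_pos _
  -- step 1: replace `C` by `max C 0`
  have h1 : |f x - x| ≤ max C 0 * x / Real.exp (c * Real.sqrt L) := by
    refine (hf x hx).trans ?_
    gcongr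
    exact le_max_left _ _
  -- step 2: `1 / exp(c √L) ≤ (2k)! / (c^{2k} L^k)`
  have h2 : max C 0 * x / Real.exp (c * Real.sqrt L) ≤
      max C 0 * x * ((2 * k).factorial / (c ^ (2 * k) * L ^ k)) := by
    rw [div_eq_mul_one_div (max C 0 * x)]
    refine mul_le_mul_of_nonneg_left ?_ (by positivity)
    rw [div_le_div_iff₀ hE (by positivity), one_mul]
    have := pow_mul_pow_div_factorial_le_exp_sqrt hc.le hL.le k
    rw [div_le_iff₀ hfact] at this
    linarith
  -- step 3: `L^A (log 2)^{k-A} ≤ L^k`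
  have h3 : L ^ A * Real.log 2 ^ ((k : ℝ) - A) ≤ L ^ k := by
    calc L ^ A * Real.log 2 ^ ((k : ℝ) - A) ≤ L ^ A * L ^ ((k : ℝ) - A) := by
          gcongr
      _ = L ^ (k : ℝ) := by rw [← Real.rpow_add hL]; ring_nf
      _ = L ^ k := Real.rpow_natCast L k
  have hLA : 0 < L ^ A := Real.rpow_pos_of_pos hL A
  have hl2k : 0 < Real.log 2 ^ ((k : ℝ) - A) := Real.rpow_pos_of_pos hl2 _
  refine h1.trans (h2.trans ?_)
  have h4 : (2 * k).factorial / (c ^ (2 * k) * L ^ k) ≤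
      (2 * k).factorial / (c ^ (2 * k) * (L ^ A * Real.log 2 ^ ((k : ℝ) - A))) := by
    gcongr
  calc max C 0 * x * ((2 * k).factorial / (c ^ (2 * k) * L ^ k))
      ≤ max C 0 * x * ((2 * k).factorial / (c ^ (2 * k) * (L ^ A * Real.log 2 ^ ((k : ℝ) - A)))) :=
        mul_le_mul_of_nonneg_left h4 (by positivity)
    _ = max C 0 * (2 * k).factorial / c ^ (2 * k) / Real.log 2 ^ ((k : ℝ) - A) * x / L ^ A := by
        field_simp

/-- The de la Vallée Poussin error term beats every power of `log`: from
`ChebyshevThetaDeLaValleePoussin`, for every real `A` there is `C_A` with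
`|ϑ(x) − x| ≤ C_A x / (log x)^A` for all `x ≥ 2` (Montgomery–Vaughan §6.2; the form of the prime
number theorem consumed by Bombieri–Vinogradov-type statements). [folklore] -/
theorem ChebyshevThetaDeLaValleePoussin.logPow (h : ChebyshevThetaDeLaValleePoussin) (A : ℝ) :
    ∃ C : ℝ, ∀ x : ℝ, 2 ≤ x → |Chebyshev.theta x - x| ≤ C * x / Real.log x ^ A := by
  obtain ⟨c, hc, C, hC⟩ := h
  exact logPow_of_expSqrt hc hC A

/-- The same for `ψ`: from `ChebyshevPsiDeLaValleePoussin`, for every real `A` there is `C_A` with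
`|ψ(x) − x| ≤ C_A x / (log x)^A` for all `x ≥ 2`. [folklore] -/
theorem ChebyshevPsiDeLaValleePoussin.logPow (h : ChebyshevPsiDeLaValleePoussin) (A : ℝ) :
    ∃ C : ℝ, ∀ x : ℝ, 2 ≤ x → |Chebyshev.psi x - x| ≤ C * x / Real.log x ^ A := by
  obtain ⟨c, hc, C, hC⟩ := h
  exact logPow_of_expSqrt hc hC A

end Literature.NumberTheory.LFunctions
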